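/-
COR-CM (cell pub-hodgecm2, stage 2 of the Hodge ladder) — Δ2 BRIDGE, the μ ↦ μᶜ ADAPTER at the literal pin, SUB-LEMMA (A4):
the (c)+(d) binders `MC ∕ jHC ∕ hjHinjC ∕ hjHC ∕ piecesC` of ✔ `AdapterMuConj.thm418C_liuDictionaryPin_of_muConj` (p373344) BY VALUE at
the LITERAL (ι₁-keyed) pinned dictionary — one existential per served line and character, from the END's own rows `hU7 ∕ h ∕ h6 ∕ h21`,
the tree's variety-side supply (J2 cofan along `ῑ₁`, S1 through `ῑ₁`) and the μ-uniform carriers `U` of the line.  ONE COROLLARY of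
d2bridge-prove-3's ✔ `exists_jRecord_pieces_livePin_of_admTransport` (`JRecordPiecesByValue.lean` §3): at the CONJUGATE-CHARACTER tail
`ν := μᶜ` (so that the relabelled family `muConj U` carries the line's own oscillator blocks `U.omega μ …`, `(μᶜ)ᶜ = μ`), the admissibility
transport that §3 isolates — `IsReflexOfTypeG ῑ₁ Φ_ν → IsReflexOfTypeG ι₁ (typeOfLine (line i))` — is TRUE: `Φ_ν = Φ̄_μ` and
«`(ῑ₁, Φ̄)`-admissible = `(ι₁, Φ)`-admissible» (✔ `AdapterRelabel.isReflexOfTypeG_cmType_iff_starRingEnd_comp_galConj`, adapt-3; own-crow K1),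
with `Φ_μ = typeOfLine (line i)` the Ω-pin's key (T-SIGN = MIRROR).  Seat prover-pub-hodgecm2-d2bridge-prove-7-g1-0 (d2bridge-prove-7).
THEOREMS ONLY (kernel lane): no definition, no instance, no named fact, no `sorry`; nothing landed is edited or restated.
FRAMING: HC_CM is NOT proved; «Δ2 BRIDGE CLOSED» is NOT claimed; nothing here is a display or a pointer move.
-/
import Summits.HodgeConjecture.CorCM.D2Bridge.JRecordPiecesByValue
import Summits.HodgeConjecture.CorCM.D2Bridge.AdapterMuConj
import Summits.HodgeConjecture.CorCM.D2Bridge.AdapterMuConjRelabel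
import HarnessLib

set_option autoImplicit false

/-!
# Δ2 bridge, (c)+(d) BY VALUE at the LITERAL pin through the μ ↦ μᶜ adapter

[Liu2021] Y. Liu, *Fourier–Jacobi cycles and arithmetic relative trace formula*, Camb. J. Math. **9** (2021) = arXiv:2102.11518
(`l. NNNN` = lines of the author's TeX `FJcycle.tex`).

At a line `i` of the literal pinned dictionary `HodgeCM.Model.liuDictionaryPin hHD hI h₁ h₃ hA V I line` (written out over
`LiuDictionary.ofTower`: `PhiMu i := PhiMuLine ι₁ (line i)`, `adm i d := d.IsReflexOfTypeG ι₁ (typeOfLine (line i))`) served by the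
Ω-pin with character `μ` (`hΦμ : HasCMType L μ (line i).lineType`), take the tail of [Liu2021, Thm. 4.18] at the CONJUGATE character
`μᶜ := μ ∘ c` (Rem. 4.4; conjugate symplectic of weight one with `Φ_{μᶜ} = Φ̄_μ`), presented through `ι₁` exactly as the END's tails
(`restTailOne (AlgHom.id ℚ L) ι₁ … (ofPolDR μᶜ (PolDR ι₁ … (RMuForm ι₁ …))) (𝒯.rhoΩOne …)`), and the relabelled uniform carriers
`muConj U` (✔ `AdapterMuConj.muConj`: summand at `(ν, ε, χ)` = `U.omega νᶜ … ε χ`).  Then the five (c)(d) binders of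
✔ `AdapterMuConj.thm418C_liuDictionaryPin_of_muConj` at `(i, μ)` are INHABITED:

* `exists_jRecord_pieces_livePin_muConj` — `∃ M jH, Injective jH ∧ (jH equivariant) ∧ ∀ K ≤ Level.capThree K₀, Nonempty (HcmPieces …
  ((liuDictionaryPin …).cmClasses K i))` at the rest `(muConj U).rest 𝔱⟦μᶜ⟧`.  Proof: prove-3's `exists_jRecord_pieces_livePin_of_admTransport`
  at the character `μᶜ` (`hμ.galConj`, `hw.galConj_complexConj`) and the carriers `muConj U`, its one input `hadm` being the TRUE direction
  «`(ῑ₁, Φ_{μᶜ})`-reflex ⟹ `(ι₁, Φ_μ)`-reflex» (`isReflexOfTypeG_cmType_iff_starRingEnd_comp_galConj`, `.mpr`) followed by the key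
  `Φ_μ = typeOfLine (line i)` (`HasCMType.unique`).  (At the SAME-character tail this input is the refuted K5; at `μᶜ` it is K1.)

The geometric content is Liu's proof of Thm. 4.18 read for the pair `(X = M^{(c)}, A_{μᶜ})`, whose classes on the tree's pieces
`P_Γ(V) ↪ X_K ⊗_{L,ῑ₁} ℂ` are pull-backs of the inclusion-eigenclass of `A_{μᶜ} ⊗_{L,ῑ₁} ℂ` — of Hodge type (1,0), since `ῑ₁ ∈ Φ̄_μ = Φ_{μᶜ}`
— i.e. CM classes of `(ι₁, Φ_μ)`-admissible records, as the literal key demands.  CONSUMER RECIPE (END §A over the adapter):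
`choose MC jHC hjHinjC hjHC hP using fun i hμi hg => exists_jRecord_pieces_livePin_muConj … (𝕌 i) h21 (hμ i) (hw i) (hcm i)`,
`piecesC := fun … K hK => Classical.choice (hP … K hK)`, `ν i := galConj c (μ i)`, `hνμ i := (galConj_complexConj_galConj_complexConj _).symm`.
Nothing about Liu's objects is asserted.  HC_CM is NOT proved; «Δ2 BRIDGE CLOSED» is NOT claimed.

## References
* [Liu2021] Thm. 4.18 (ll. 2232–2245) with proof (l. 2247–2253: «fix τ′ ∈ Φ_μ»), Thm. 4.18 (1) (l. 2239), Rem. 4.17 (l. 2226–2228),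
  Lem. 2.4 (1) (l. 1210–1228), Def. 4.3 (2) (l. 1919), Rem. 4.4 (ll. 1912–1933), Def. 4.5 (2) (l. 1944–1951), Prop. 4.6 (1) (l. 1969),
  Def. 4.12 (ll. 2102–2111).
* [Shimura1998] G. Shimura, *Abelian Varieties with Complex Multiplication and Modular Functions* (1998), Thm. 21.4; §8.3 Prop. 28.
* Tree: `CorCM/D2Bridge/{JRecordPiecesByValue, AdapterMuConj, AdapterMuConjRelabel, HcmPiecesAtPinConjInst, ComponentAlbanesePin}.lean`,
  `Literature/NumberTheory/Automorphic/IdeleClassCharacterConjugate.lean`.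
-/

noncomputable section

open scoped TensorProduct
open CategoryTheory NumberField Function
open Literature.AlgebraicGeometry.Motives (AbelianVariety bettiCohomology)
open Literature.AlgebraicGeometry.HodgeTheory
open Literature.AlgebraicGeometry.ShimuraVarieties.UnitaryCanonicalModel (exists_recordSystem heckeTranslate_definedOver)
open Literature.NumberTheory.Automorphic Literature.NumberTheory.Automorphic.Liu2021 Literature.NumberTheory.Automorphic.Liu2021.AppendixC
open Literature.NumberTheory.Automorphic.Liu2021.AppendixC.RestOne
open Literature.NumberTheory.Automorphic.PicardCM
open Literature.NumberTheory.Automorphic.IdeleClassGroup (galConj)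
open Literature.NumberTheory.ComplexMultiplication (shimura1998_thm21_4_casselman)
open Literature.NumberTheory.Transcendental (Arapura2012_Cor_15_4_6)
open HodgeCM HodgeCM.Model HodgeCM.Model.LevelTranslate HodgeCM.Model.TowerLevel HodgeCM.Model.TowerCarrier
open Summit.HodgeConjecture.CorCM.D2Bridge.TowerRational
open Summit.HodgeConjecture.CorCM.Model (sec42DataOf sec42DataOf_heckeTranslates heckeTranslatesFamilyOf)
open Summit.HodgeConjecture.CorCM.D2Bridge.AdapterMuConj (muConj)
open Summit.HodgeConjecture.CorCM.D2Bridge.AdapterRelabel (isReflexOfTypeG_cmType_iff_starRingEnd_comp_galConj)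

namespace Summit.HodgeConjecture.CorCM.D2Bridge

section LivePinMuConj

open HodgeCM.Literature.Theta.LiuAlbaneseModuleDatum.D2Bridge (HcmPieces)

variable {L : HodgeCM.CMField} [IsGalois ℚ (L : Type)] {ι₁ : L →+* ℂ}
variable {μ : Literature.NumberTheory.Automorphic.IdeleClassGroup L →ₜ* Circle}

set_option synthInstance.maxHeartbeats 400000 in
set_option maxHeartbeats 3200000 in
/-- **(c)+(d) BY VALUE AT THE LITERAL PIN, THROUGH THE ADAPTER.**  At the literal pinned dictionary (written out:
`PhiMu i := PhiMuLine ι₁ (line i)`, `adm i d := d.IsReflexOfTypeG ι₁ (typeOfLine (line i))`), for a line `i` and a character `μ` with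
`HasCMType L μ (line i).lineType` (the Ω-pin's key), the (c)(d) binders of ✔ `AdapterMuConj.thm418C_liuDictionaryPin_of_muConj` at
the relabelled carriers `muConj U` and the END-shaped tail at the CONJUGATE character `μᶜ = galConj c μ` ([Liu2021] Rem. 4.4) are
inhabited: THERE ARE a rational (4.3) record `M` and an injective equivariant `jH : M.HB → H` into the tower with the pieces
`HcmPieces … ((liuDictionaryPin …).cmClasses K i)` at every level `K ≤ Level.capThree K₀`.  Witnesses = prove-3's
✔ `exists_jRecord_pieces_livePin_of_admTransport` at `(μᶜ, muConj U)`, whose admissibility input is discharged by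
✔ `isReflexOfTypeG_cmType_iff_starRingEnd_comp_galConj` (`(ῑ₁, Φ_{μᶜ})`-reflex ⟹ `(ι₁, Φ_μ)`-reflex) and `Φ_μ = typeOfLine (line i)`
(`HasCMType.unique`).  HC_CM is NOT proved; «Δ2 BRIDGE CLOSED» is NOT claimed.
[cite: Liu2021, Thm. 4.18 (1) (FJcycle.tex l. 2239), proof of Thm. 4.18 (l. 2247–2253), Rem. 4.4 (ll. 1930–1933), Def. 4.3 (2) (l. 1919), Def. 4.5 (2) (l. 1944–1951), Prop. 4.6 (1) (l. 1969), Lem. 2.4 (1) (l. 1210–1228)] [cite: Shimura1998, §21.4 Thm. 21.4; §8.3 Prop. 28] -/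
theorem exists_jRecord_pieces_livePin_muConj (hHD : exists_isReal_hodgeModel) (hI : hodgePQ_independent_of_hodgeModel)
    (h₁ : BallQuotientUniformised) (h₃ : CMAbelianVarietyRealised) (hA : Arapura2012_Cor_15_4_6)
    (hU7 : heckeTranslate_definedOver) {h : exists_recordSystem} (V : HodgeCM.HermSpace3 L ι₁) (h6 : 6 ≤ Module.finrank ℚ (L : Type))
    (Φ : Literature.AlgebraicGeometry.Motives.CMType L)
    (iso : ∀ (F : Summit.HodgeConjecture.CorCM.CMField) (ι : F →+* ℂ) (_ : Summit.HodgeConjecture.CorCM.HermSpace3 F ι)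
      (_ : Literature.AlgebraicGeometry.Motives.CMType F), ℕ → Prop)
    (I : Type) (line : I → HodgeCM.Model.SplitLineE V) (i : I)
    (U : UniformOmega (sec42DataOf h iso (pkgF L) ι₁ (pkgV V) Φ)) (h21 : shimura1998_thm21_4_casselman)
    (hμ : Literature.NumberTheory.Automorphic.IdeleClassGroup.IsConjugateSymplectic L μ)
    (hw : Literature.NumberTheory.Automorphic.IdeleClassGroup.HasWeight L μ 1)
    (hΦμ : Literature.NumberTheory.Automorphic.IdeleClassGroup.HasCMType L μ (line i).lineType) :
    ∃ (M : (toThm418Data (sec42DataOf h iso (pkgF L) ι₁ (pkgV V) Φ)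
          ((muConj U).rest (restTailOne (AlgHom.id ℚ (L : Type)) ι₁ hμ.galConj hw.galConj_complexConj
            (Def45.Carriers.ofPolDR (galConj (IsCMField.complexConj (L : Type)) μ)
              (Def45.PolDR ι₁ hμ.galConj (Def45.RMuForm ι₁ hμ.galConj)))
            ((heckeTranslatesFamilyOf hU7 h iso (pkgF L) ι₁ (pkgV V) Φ h6).rhoΩOne (AlgHom.id ℚ (L : Type)) ι₁ hμ.galConj
              hw.galConj_complexConj
              (Def45.Carriers.ofPolDR (galConj (IsCMField.complexConj (L : Type)) μ)
                (Def45.PolDR ι₁ hμ.galConj (Def45.RMuForm ι₁ hμ.galConj))))))).Map43RationalData)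
      (jH : M.HB →ₗ[ℂ] (LiuDictionary.ofTower hHD hI h₁ h₃ hA V I (fun i => {χ : (line i).CharW // (line i).IsAutChar χ})
          (fun i a => (line i).Ω (HodgeCM.Model.ιVE V) a.1)
          (fun i => HodgeCM.Model.SplitLine.PhiMuLine ι₁ (line i))
          (fun i dd => dd.IsReflexOfTypeG ι₁ (HodgeCM.Model.SplitLine.typeOfLine (line i)))).H),
      Function.Injective jH ∧
      (∀ (g : ↥V.adelicFin) (x : M.HB), jH (M.ρB g x) = MonoidAlgebra.of ℂ ↥V.adelicFin g • jH x) ∧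
      ∀ K : HodgeCM.Level V,
        K ≤ Level.capThree (V := V) ((sec42DataOf h iso (pkgF L) ι₁ (pkgV V) Φ).S.K₀.1 : Subgroup ↥V.adelicFin)
          (sec42DataOf h iso (pkgF L) ι₁ (pkgV V) Φ).S.K₀.2.1 →
        Nonempty (HcmPieces.{0, 1, 0}
          (toThm418Data (sec42DataOf h iso (pkgF L) ι₁ (pkgV V) Φ)
            ((muConj U).rest (restTailOne (AlgHom.id ℚ (L : Type)) ι₁ hμ.galConj hw.galConj_complexConj
              (Def45.Carriers.ofPolDR (galConj (IsCMField.complexConj (L : Type)) μ)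
                (Def45.PolDR ι₁ hμ.galConj (Def45.RMuForm ι₁ hμ.galConj)))
              ((heckeTranslatesFamilyOf hU7 h iso (pkgF L) ι₁ (pkgV V) Φ h6).rhoΩOne (AlgHom.id ℚ (L : Type)) ι₁ hμ.galConj
                hw.galConj_complexConj
                (Def45.Carriers.ofPolDR (galConj (IsCMField.complexConj (L : Type)) μ)
                  (Def45.PolDR ι₁ hμ.galConj (Def45.RMuForm ι₁ hμ.galConj)))))))
          M
          (LiuDictionary.ofTower hHD hI h₁ h₃ hA V I (fun i => {χ : (line i).CharW // (line i).IsAutChar χ})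
            (fun i a => (line i).Ω (HodgeCM.Model.ιVE V) a.1)
            (fun i => HodgeCM.Model.SplitLine.PhiMuLine ι₁ (line i))
            (fun i dd => dd.IsReflexOfTypeG ι₁ (HodgeCM.Model.SplitLine.typeOfLine (line i)))).H jH K.K
          ((picardCMUniverse hHD hI h₁ h₃).CohC ((picardCMUniverse hHD hI h₁ h₃).pms L ι₁ V K) 1)
          (resTotal hHD hI (ballQuotientUniformisedDatum_of h₁) h₃ hA K)
          ((LiuDictionary.ofTower hHD hI h₁ h₃ hA V I (fun i => {χ : (line i).CharW // (line i).IsAutChar χ})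
            (fun i a => (line i).Ω (HodgeCM.Model.ιVE V) a.1)
            (fun i => HodgeCM.Model.SplitLine.PhiMuLine ι₁ (line i))
            (fun i dd => dd.IsReflexOfTypeG ι₁ (HodgeCM.Model.SplitLine.typeOfLine (line i)))).cmClasses K i)) := by
  -- the Ω-pin's key, T-SIGN = MIRROR: `Φ_μ = Φ^δ(a_i)`
  have hΦ : hμ.cmType = HodgeCM.Model.SplitLine.typeOfLine (line i) :=
    Literature.NumberTheory.Automorphic.IdeleClassGroup.HasCMType.unique hμ.hasCMType_cmType hΦμ
  exact exists_jRecord_pieces_livePin_of_admTransport hHD hI h₁ h₃ hA hU7 V h6 Φ iso I line i (muConj U) h21 hμ.galConj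
    hw.galConj_complexConj
    -- K1 (TRUE direction): `(ῑ₁, Φ_{μᶜ})`-reflex ⟹ `(ι₁, Φ_μ)`-reflex, then the key
    (fun d hd => hΦ ▸ (isReflexOfTypeG_cmType_iff_starRingEnd_comp_galConj ι₁ d hμ).mpr hd)

end LivePinMuConj

end Summit.HodgeConjecture.CorCM.D2Bridge

end
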